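import Summits.CriticalPhenomena.Ising3DConformalLimit.Theses.UnitLightCone
import Summits.CriticalPhenomena.Ising3DConformalLimit.Theorems.GaussianScaleMixtureRotationUpgradeFromTwoPoint
import HarnessLib

/-!
# Crux `UnitLightCone.TwoPointIsotropyToAllN` (item stmt-CriticalPhenomena-17168) — birth file (BC3)

Route `route-CriticalPhenomena-UnitLightCone`, crux (N) rank 3:
`Summit.CriticalPhenomena.Ising3DConformalLimit.Theses.UnitLightCone.TwoPointIsotropyToAllN` — for every
normalised, non-degenerate, translation-invariant, scale-covariant pointwise scaling limit `S` of
`criticalCorr 3`, `O(3)`-invariance of the two-point kernel `S 2 (0, R x) = S 2 (0, x)` implies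
`IsRotationInvariant S` (all `n`).

## Finding of the skeleton registrar (planner-skel-stmt-CriticalPhenomena-17168-0, 2026-08-17)

THE CRUX IS PROVABLE NOW — it is, up to DROPPING the guard `x ≠ 0` in its isotropy hypothesis, verbatim the
crux `GaussianScaleMixture.RotationUpgradeFromTwoPoint` (item stmt-CriticalPhenomena-8367), CLOSED · PROVED
2026-08-16T22:36Z by the landed, sorry-free theorem
`Summit.CriticalPhenomena.Ising3DConformalLimit.Cruxes.RotationUpgradeFromTwoPoint.NullLaplacianEdgeGaussianity.rotationUpgradeFromTwoPoint_proof`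
(`Theorems/GaussianScaleMixtureRotationUpgradeFromTwoPoint.lean`, gate link `OrthogonalFrameTP2.RotationUpgradeFromTwoPoint_holds`
@ 97caabcac6d4).  Since `RotationUpgradeFromTwoPoint` assumes two-point isotropy only for `x ≠ 0`, it is the
STRONGER statement, and `TwoPointIsotropyToAllN` follows from it by the two-line term below (the same term the
grounder attached as candidate proof `TwoPointIsotropyToAllNProof.lean`, 2026-08-16T23:02Z).

Consequently the honest skeleton of this crux has ZERO stubs: any `stub_*` would either restate a landed theorem
(churn for stub provers) or be the crux in costume (BC3 `line.shredded`).  This file therefore records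
* `TwoPointIsotropyToAllN_of_rotationUpgrade : RotationUpgradeFromTwoPoint → TwoPointIsotropyToAllN` — the reduction
  (implication form, the "composition" of the degenerate skeleton), and
* `TwoPointIsotropyToAllN_of : TwoPointIsotropyToAllN` — the crux BY NAME, hypothesis-free and sorry-free, from the
  landed theorem.
`lean check --json`: rc 0, errors [], sorries 0 (= number of stubs, 0), axioms of `TwoPointIsotropyToAllN_of` ⊆
{propext, Classical.choice, Quot.sound}.  BC3 probes are vacuous (no stub); BC4 (dedup) is HIT: the crux is an
existing proved item — the route should cite `RotationUpgradeFromTwoPoint_holds` by name / have a prover land this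
file's `TwoPointIsotropyToAllN_of` as `Theorems/UnitLightConeTwoPointIsotropyToAllN.lean --workitem stmt-CriticalPhenomena-17168`
(planners do not propose proofs).
-/

namespace Summit.CriticalPhenomena.Ising3DConformalLimit.Cruxes.TwoPointIsotropyToAllN.Birth

/-- Reduction (the whole "line"): the landed sibling crux `RotationUpgradeFromTwoPoint` (two-point isotropy assumed
only off the origin) implies `TwoPointIsotropyToAllN` (two-point isotropy assumed everywhere) — drop the guard.
[folklore] -/
theorem TwoPointIsotropyToAllN_of_rotationUpgrade
    (h : _root_.Summit.CriticalPhenomena.Ising3DConformalLimit.Theses.GaussianScaleMixture.RotationUpgradeFromTwoPoint) :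
    _root_.Summit.CriticalPhenomena.Ising3DConformalLimit.Theses.UnitLightCone.TwoPointIsotropyToAllN := by
  intro ρ Δ S hρ hlim hnorm hnd htr hsc hiso
  exact h ρ Δ S hρ hlim hnorm hnd htr hsc (fun R x _ => hiso R x)

/-- **`TwoPointIsotropyToAllN_of` — the crux BY NAME, sorry-free**, from the landed theorem
`rotationUpgradeFromTwoPoint_proof` (item stmt-CriticalPhenomena-8367, proved). [folklore] -/
theorem TwoPointIsotropyToAllN_of :
    _root_.Summit.CriticalPhenomena.Ising3DConformalLimit.Theses.UnitLightCone.TwoPointIsotropyToAllN :=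
  TwoPointIsotropyToAllN_of_rotationUpgrade
    _root_.Summit.CriticalPhenomena.Ising3DConformalLimit.Cruxes.RotationUpgradeFromTwoPoint.NullLaplacianEdgeGaussianity.rotationUpgradeFromTwoPoint_proof

end Summit.CriticalPhenomena.Ising3DConformalLimit.Cruxes.TwoPointIsotropyToAllN.Birth
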